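import Summits.QuantumAdvantage.QuantumAdvantage.Theorems.EchoDialD

/-! # EchoDialE — part 5/5 of the landing twins of NODE «EchoDial» (decomp-qadv lens-2; node file
`g22/EchoDial.lean`, sha256 2019ca7807e3a40c…; generator `g23/tree/gen_twins.py`: namespace
`Theses.EchoDial` → `Theorems.EchoDial`, cut at declaration boundaries, docstrings added where missing, nothing else).
Content: §5(c-part-2) the counter along a generic orbit (`lodd_orbF_gen`), the `(d+1)`-subcube behind the first two sites, and
the HIGH-ECHO certificates `hx_not_echoDeg` / `hc_not_echoDeg` / `hx_not_stabEcho_zero`. -/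

set_option linter.dupNamespace false
noncomputable section
open scoped Classical

namespace Summit.QuantumAdvantage.QuantumAdvantage.Theorems.EchoDial
open Finset
open Literature.Computability.QuantumComplexity Literature.Computability.QuantumComplexity.RingHLF
open Literature.Computability.MetaComplexity Literature.Computability.MetaComplexity.Smolensky
open Summit.QuantumAdvantage.AdviceFreeQNC0 hiding sgn3
open Summit.QuantumAdvantage.QuantumAdvantage.Theorems.AnchorDial (outB dev cN orbF cN_orbF_cast oddZeros_orbF
  orbF_apply_of_far card_filter_orbF orbF_false win_iff gCond_iff_cN three_counts card_odd_ge loss_shape_mono)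
open Summit.QuantumAdvantage.QuantumAdvantage.Theorems.AnchorDial.Core (ct sg)
open Summit.QuantumAdvantage.QuantumAdvantage.Theorems.HolonomyDial (gCond card_odd_le)
open Summit.QuantumAdvantage.QuantumAdvantage.Theorems.StabilizerDial (pad pad_mem rel_pad_iff StabFew apStrat apStrat_mem)
open Summit.QuantumAdvantage.QuantumAdvantage.Theorems.SparsityDial (stabFew_mono_mr one_le_logpow)
open Summit.QuantumAdvantage.QuantumAdvantage.Theorems.ResponseDial (lodd lodd_mem lodd_eq_sum qpoly qpoly_mem qbit qpoly_apply
  hcStrat mem_dev_hcStrat_iff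
  sgn3 sgn3_ne dev_pad_zero not_polylogSparse_of_agree orbF_apply mod3_ne_two castZ2_of_mod_eq_zero
  castZ2_of_mod_eq_one εOf sF lam CertOK certOK_lam AddResp)
open Summit.QuantumAdvantage.QuantumAdvantage.Theses.SparsityDial (DenseGenericLoss3)
open Summit.QuantumAdvantage.QuantumAdvantage.Theorems.CounterDial (StabCounter CounterLoss3 NonCounterGenericLoss3 lin CounterForm
  xloc xloc_castLE oddZeros_xloc lin_xloc bsel mem_iff_bsel card_false_five)
open Summit.QuantumAdvantage.QuantumAdvantage.Theorems.HolonomyDial (tPoly tPoly_mem tPoly_apply xorP xorP_mem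
  xorP_apply_bool mono_singleton_apply)

section Inhabitant
variable {N : ℕ}

/-! #### the counter along the orbit (generic number of sites; cf. the tree's `lodd_orbF` for five) -/

/-- the odd-indexed cell of the `i`-th flipped pair. -/
def oddSiteF {F : ℕ} {b : Fin F → ℕ} (hbN : ∀ i, b i + 3 ≤ N) (i : Fin F) : Fin N :=
  ⟨if b i % 2 = 1 then b i else b i + 1, by have := hbN i; split_ifs <;> omega⟩

/-- the odd cell of a flipped pair has odd index. -/
theorem oddSiteF_odd {F : ℕ} {b : Fin F → ℕ} (hbN : ∀ i, b i + 3 ≤ N) (i : Fin F) :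
    (oddSiteF hbN i).val % 2 = 1 := by
  unfold oddSiteF; dsimp only; split_ifs <;> omega

/-- the odd cell of pair `i` is `b i` or `b i + 1`. -/
theorem oddSiteF_val {F : ℕ} {b : Fin F → ℕ} (hbN : ∀ i, b i + 3 ≤ N) (i : Fin F) :
    (oddSiteF hbN i).val = b i ∨ (oddSiteF hbN i).val = b i + 1 := by
  unfold oddSiteF; dsimp only; split_ifs <;> simp

/-- the odd-cell counter along an `F`-site orbit moves by `Σ_{ε_i} sgn3 (x (oddSiteF i))` (generic number of sites; cf. the tree's `lodd_orbF` for five). -/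
theorem lodd_orbF_gen {F : ℕ} {b : Fin F → ℕ} (hb : SitesF N F b) (ε : Fin F → Bool) (x : Fin N → Bool) :
    (lodd : CubeFn (ZMod 3) N) (orbF b ε x) =
      (lodd : CubeFn (ZMod 3) N) x + ∑ i, (if ε i then sgn3 (x (oddSiteF hb.2 i)) else 0) := by
  rw [← Finset.sum_filter, lodd_eq_sum, lodd_eq_sum]
  have hpt : ∀ j ∈ (univ : Finset (Fin N)).filter (fun j => j.val % 2 = 1),
      (if orbF b ε x j then (1 : ZMod 3) else 0) =
        (if x j then (1 : ZMod 3) else 0) +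
          (if (∃ i, ε i = true ∧ (j.val = b i ∨ j.val = b i + 1)) then sgn3 (x j) else 0) := by
    intro j _
    rw [orbF_apply hb.1 ε x j]
    by_cases h : ∃ i, ε i = true ∧ (j.val = b i ∨ j.val = b i + 1)
    · rw [if_pos h, if_pos h]; unfold sgn3; cases x j <;> decide
    · rw [if_neg h, if_neg h, add_zero]
  rw [sum_congr rfl hpt, sum_add_distrib]
  congr 1
  have hset : ((univ : Finset (Fin N)).filter (fun j => j.val % 2 = 1)).filter
      (fun j => ∃ i, ε i = true ∧ (j.val = b i ∨ j.val = b i + 1)) =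
        ((univ : Finset (Fin F)).filter (fun i => ε i = true)).image (oddSiteF hb.2) := by
    ext j
    simp only [mem_filter, mem_univ, true_and, mem_image]
    constructor
    · rintro ⟨hodd, i, hi, hj⟩
      refine ⟨i, hi, Fin.ext ?_⟩
      have h1 := oddSiteF_val hb.2 i
      have h2 := oddSiteF_odd hb.2 i
      rcases hj with hj | hj <;> rcases h1 with h1 | h1 <;> omega
    · rintro ⟨i, hi, rfl⟩
      exact ⟨oddSiteF_odd hb.2 i, i, hi, oddSiteF_val hb.2 i⟩
  rw [← sum_filter, hset, sum_image]
  intro i₁ hi₁ i₂ hi₂ heq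
  by_contra hne
  have hv := congrArg Fin.val heq
  have h1 := oddSiteF_val hb.2 i₁
  have h2 := oddSiteF_val hb.2 i₂
  rcases lt_or_gt_of_ne hne with hlt | hlt
  · have := hb.1 i₁ i₂ hlt; omega
  · have := hb.1 i₂ i₁ hlt; omega

/-! #### the `(d+1)`-subcube behind the first two sites -/

/-- sign patterns `(p, q, τ)`: the first two sites set to `p, q`, the next `m` to `τ`. -/
def app {m : ℕ} (p q : Bool) (τ : Fin m → Bool) : Fin (2 + m) → Bool := Fin.append ![p, q] τ

/-- reading one of the two head entries of `app p q τ`. -/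
theorem app_left {m : ℕ} (p q : Bool) (τ : Fin m → Bool) (i : Fin 2) :
    app p q τ (Fin.castAdd m i) = ![p, q] i := by
  unfold app; rw [Fin.append_left]

/-- reading a tail entry of `app p q τ`. -/
theorem app_right {m : ℕ} (p q : Bool) (τ : Fin m → Bool) (t : Fin m) :
    app p q τ (Fin.natAdd 2 t) = τ t := by
  unfold app; rw [Fin.append_right]

/-- updating a tail entry of `τ` does not change `app p q τ` at any other index. -/
theorem app_update {m : ℕ} (p q : Bool) (τ : Fin m → Bool) (t₀ : Fin m) (v : Bool) (i : Fin (2 + m))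
    (hi : i ≠ Fin.natAdd 2 t₀) : app p q (Function.update τ t₀ v) i = app p q τ i := by
  induction i using Fin.addCases with
  | left i₀ => rw [app_left, app_left]
  | right t =>
    rw [app_right, app_right]
    have ht : t ≠ t₀ := fun h => hi (by rw [h])
    rw [Function.update_of_ne ht]

/-- a sum over `Fin (2 + m)` gated by `app p q τ` splits into the two head terms and the tail sum. -/
theorem sum_app {m : ℕ} (p q : Bool) (τ : Fin m → Bool) (s : Fin (2 + m) → ZMod 3) :
    (∑ i, (if app p q τ i then s i else 0)) =
      (if p then s (Fin.castAdd m 0) else 0) + (if q then s (Fin.castAdd m 1) else 0) +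
        ∑ t, (if τ t then s (Fin.natAdd 2 t) else 0) := by
  rw [Fin.sum_univ_add, Fin.sum_univ_two, app_left, app_left]
  simp only [Matrix.cons_val_zero, Matrix.cons_val_one, app_right]
  try rfl

/-- sites behind the first two lie at `≥ 4`. -/
theorem four_le_site {m : ℕ} {b' : Fin (2 + m) → ℕ} (hb' : SitesF N (2 + m) b') (t : Fin m) :
    4 ≤ b' (Fin.natAdd 2 t) := by
  have h01 : b' (Fin.castAdd m 0) + 2 ≤ b' (Fin.castAdd m 1) :=
    hb'.1 _ _ (Fin.lt_def.2 (by simp))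
  have h1t : b' (Fin.castAdd m 1) + 2 ≤ b' (Fin.natAdd 2 t) :=
    hb'.1 _ _ (Fin.lt_def.2 (by simp only [Fin.val_castAdd, Fin.val_natAdd, Fin.val_one]; omega))
  omega

/-- the cells `≤ 2` along the orbit do not see the sites behind the first two. -/
theorem orbF_app_low {m : ℕ} {b' : Fin (2 + m) → ℕ} (hb' : SitesF N (2 + m) b') (p q : Bool)
    (τ τ₀ : Fin m → Bool) (x : Fin N → Bool) (j : Fin N) (hj : j.val ≤ 2) :
    orbF b' (app p q τ) x j = orbF b' (app p q τ₀) x j := by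
  have key : ∀ τ' : Fin m → Bool, (∃ i, app p q τ' i = true ∧ (j.val = b' i ∨ j.val = b' i + 1)) ↔
      (∃ i₀ : Fin 2, (![p, q] i₀) = true ∧
        (j.val = b' (Fin.castAdd m i₀) ∨ j.val = b' (Fin.castAdd m i₀) + 1)) := by
    intro τ'
    constructor
    · rintro ⟨i, hi, hj'⟩
      induction i using Fin.addCases with
      | left i₀ => exact ⟨i₀, by rw [← app_left p q τ' i₀]; exact hi, hj'⟩
      | right t => exfalso; have h4 := four_le_site hb' t; omega
    · rintro ⟨i₀, hi₀, hj'⟩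
      exact ⟨Fin.castAdd m i₀, by rw [app_left]; exact hi₀, hj'⟩
  rw [orbF_apply hb'.1, orbF_apply hb'.1]
  by_cases hc : ∃ i₀ : Fin 2, (![p, q] i₀) = true ∧
      (j.val = b' (Fin.castAdd m i₀) ∨ j.val = b' (Fin.castAdd m i₀) + 1)
  · rw [if_pos ((key τ).2 hc), if_pos ((key τ₀).2 hc)]
  · rw [if_neg (fun h' => hc ((key τ).1 h')), if_neg (fun h' => hc ((key τ₀).1 h'))]

/-- **subcube parity**: a monomial missing one of the free coordinates is satisfied by an even number of points. -/
theorem even_mono_count {m : ℕ} (p q : Bool) (S : Finset (Fin (2 + m))) (t₀ : Fin m)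
    (ht₀ : Fin.natAdd 2 t₀ ∉ S) :
    2 ∣ (univ.filter fun τ : Fin m → Bool => ∀ i ∈ S, app p q τ i = true).card := by
  set X := univ.filter fun τ : Fin m → Bool => ∀ i ∈ S, app p q τ i = true with hX
  let flip : (Fin m → Bool) → (Fin m → Bool) := fun τ => Function.update τ t₀ (!τ t₀)
  have hflip2 : ∀ τ, flip (flip τ) = τ := by
    intro τ; funext t
    by_cases h : t = t₀
    · subst h; simp [flip]
    · simp [flip, Function.update_of_ne h]
  have hmemX : ∀ τ, τ ∈ X ↔ ∀ i ∈ S, app p q τ i = true := fun τ => by simp [hX]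
  have hkey : ∀ τ, flip τ ∈ X ↔ τ ∈ X := by
    intro τ
    rw [hmemX, hmemX]
    have h : ∀ i ∈ S, app p q (flip τ) i = app p q τ i := fun i hi =>
      app_update p q τ t₀ _ i (fun h => ht₀ (h ▸ hi))
    exact ⟨fun H i hi => (h i hi) ▸ H i hi, fun H i hi => (h i hi).symm ▸ H i hi⟩
  have himg : (X.filter fun τ => τ t₀ = false).image flip = X.filter fun τ => τ t₀ = true := by
    ext τ
    simp only [mem_image, mem_filter]
    constructor
    · rintro ⟨τ', ⟨hτ'X, hτ'f⟩, rfl⟩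
      exact ⟨(hkey τ').2 hτ'X, by simp [flip, hτ'f]⟩
    · rintro ⟨hτX, hτt⟩
      exact ⟨flip τ, ⟨(hkey τ).2 hτX, by simp [flip, hτt]⟩, hflip2 τ⟩
  have hinj : Function.Injective flip := fun τ₁ τ₂ h => by
    have := congrArg flip h; rwa [hflip2, hflip2] at this
  have hc := Finset.card_filter_add_card_filter_not (s := X) (fun τ : Fin m → Bool => τ t₀ = true)
  have hneg : (X.filter fun τ => ¬ τ t₀ = true) = X.filter fun τ => τ t₀ = false :=
    filter_congr fun τ _ => by simp
  rw [hneg, ← himg, card_image_of_injective _ hinj] at hc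
  exact ⟨_, by rw [← hc]; ring⟩

/-- the parity of a sum of naturals is the parity of the number of odd summands. -/
theorem sum_mod_two_eq_card {α : Type*} [DecidableEq α] (s : Finset α) (f : α → ℕ) :
    (∑ a ∈ s, f a) % 2 = (s.filter fun a => f a % 2 = 1).card % 2 := by
  induction s using Finset.induction_on with
  | empty => simp
  | insert a s ha ih =>
    rw [sum_insert ha, filter_insert]
    by_cases h : f a % 2 = 1
    · rw [if_pos h, card_insert_of_notMem (fun h' => ha (mem_filter.1 h').1)]; omega
    · rw [if_neg h]; omega

/-- xoring with a constant does not change the parity of a count over a cube of positive dimension. -/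
theorem card_xor_const_mod_two {m : ℕ} (hm : 1 ≤ m) (g : (Fin m → Bool) → Bool) (κ : Bool) :
    (univ.filter fun τ : Fin m → Bool => xor (g τ) κ = true).card % 2 =
      (univ.filter fun τ : Fin m → Bool => g τ = true).card % 2 := by
  cases κ
  · have e : (univ.filter fun τ : Fin m → Bool => xor (g τ) false = true) =
        univ.filter fun τ : Fin m → Bool => g τ = true := filter_congr fun τ _ => by rw [Bool.xor_false]
    rw [e]
  · have hc := Finset.card_filter_add_card_filter_not
      (s := (univ : Finset (Fin m → Bool))) (fun τ : Fin m → Bool => g τ = true)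
    have hU : (univ : Finset (Fin m → Bool)).card = 2 ^ m := by simp [card_univ]
    have he : (univ.filter fun τ : Fin m → Bool => xor (g τ) true = true) =
        univ.filter fun τ : Fin m → Bool => ¬ g τ = true := filter_congr fun τ _ => by simp
    rw [he]
    obtain ⟨m', rfl⟩ : ∃ m', m = m' + 1 := ⟨m - 1, by omega⟩
    rw [hU, pow_succ] at hc
    omega

/-- **the `MOD₃`-slice core**: on the orbit cube of `2 + (d+1)` separated sites, no family of monomials of size `≤ d`
has the parity `[L + Σ_i s_i ε_i ≡ 0] ⊕ κ(ε)` when the weights are non-zero and `κ` sees only the first two sites. -/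
theorem slice_not_lowDeg {d : ℕ} (s : Fin (2 + (d + 1)) → ZMod 3) (hs : ∀ i, s i ≠ 0) (L : ZMod 3)
    (κ : (Fin (2 + (d + 1)) → Bool) → Bool) (hκ : ∀ p q τ, κ (app p q τ) = κ (app p q fun _ => false))
    (M : Finset (Finset (Fin (2 + (d + 1))))) (hMd : ∀ S ∈ M, S.card ≤ d)
    (hM : ∀ ε, xor (decide (L + ∑ i, (if ε i then s i else 0) = 0)) (κ ε) = true ↔
      (M.filter fun S => ∀ i ∈ S, ε i = true).card % 2 = 1) : False := by
  -- the count on the subcube behind the first two sites, for signs (p, q)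
  have hcount : ∀ p q : Bool,
      (univ.filter fun τ : Fin (d + 1) → Bool =>
        xor (decide (L + ∑ i, (if app p q τ i then s i else 0) = 0)) (κ (app p q τ)) = true).card % 2 =
        cnt3 (fun t => s (Fin.natAdd 2 t))
          (L + (if p then s (Fin.castAdd (d + 1) 0) else 0) + (if q then s (Fin.castAdd (d + 1) 1) else 0)) % 2 := by
    intro p q
    have e : (univ.filter fun τ : Fin (d + 1) → Bool =>
        xor (decide (L + ∑ i, (if app p q τ i then s i else 0) = 0)) (κ (app p q τ)) = true) =
        univ.filter fun τ : Fin (d + 1) → Bool =>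
          xor (decide (L + (if p then s (Fin.castAdd (d + 1) 0) else 0) +
            (if q then s (Fin.castAdd (d + 1) 1) else 0) +
              ∑ t, (if τ t then s (Fin.natAdd 2 t) else 0) = 0)) (κ (app p q fun _ => false)) = true := by
      refine filter_congr fun τ _ => ?_
      rw [sum_app, ← add_assoc, ← add_assoc, hκ p q τ]
    rw [e, card_xor_const_mod_two (by omega)]
    unfold cnt3
    congr 2
    exact filter_congr fun τ _ => by rw [decide_eq_true_iff]
  -- EVEN: degree ≤ d forces every such count to be even
  have heven : ∀ p q : Bool,
      (univ.filter fun τ : Fin (d + 1) → Bool =>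
        xor (decide (L + ∑ i, (if app p q τ i then s i else 0) = 0)) (κ (app p q τ)) = true).card % 2 = 0 := by
    intro p q
    have hfree : ∀ S ∈ M, ∃ t₀ : Fin (d + 1), Fin.natAdd 2 t₀ ∉ S := by
      intro S hS
      have hlt : S.card < ((univ : Finset (Fin (d + 1))).map (Fin.natAddEmb 2)).card := by
        rw [card_map, card_univ, Fintype.card_fin]; exact Nat.lt_succ_of_le (hMd S hS)
      obtain ⟨i, hi, hiS⟩ := exists_mem_notMem_of_card_lt_card hlt
      obtain ⟨t₀, _, rfl⟩ := mem_map.1 hi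
      exact ⟨t₀, hiS⟩
    have h2 : 2 ∣ ∑ τ : Fin (d + 1) → Bool, (M.filter fun S => ∀ i ∈ S, app p q τ i = true).card := by
      have hswap : (∑ τ : Fin (d + 1) → Bool, (M.filter fun S => ∀ i ∈ S, app p q τ i = true).card) =
          ∑ S ∈ M, (univ.filter fun τ : Fin (d + 1) → Bool => ∀ i ∈ S, app p q τ i = true).card := by
        simp only [card_filter]
        exact Finset.sum_comm
      rw [hswap]
      exact Finset.dvd_sum fun S hS => by
        obtain ⟨t₀, ht₀⟩ := hfree S hS
        exact even_mono_count p q S t₀ ht₀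
    have hpar := sum_mod_two_eq_card (univ : Finset (Fin (d + 1) → Bool))
      (fun τ => (M.filter fun S => ∀ i ∈ S, app p q τ i = true).card)
    have e : (univ.filter fun τ : Fin (d + 1) → Bool =>
        (M.filter fun S => ∀ i ∈ S, app p q τ i = true).card % 2 = 1) =
          univ.filter fun τ : Fin (d + 1) → Bool =>
            xor (decide (L + ∑ i, (if app p q τ i then s i else 0) = 0)) (κ (app p q τ)) = true :=
      filter_congr fun τ _ => by rw [← hM (app p q τ)]
    rw [e] at hpar
    omega
  -- ODD: some residue class of the counter is odd on the subcube, and the first two sites reach it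
  obtain ⟨⟨a, ha⟩, -⟩ := cnt3_parity (fun t : Fin (d + 1) => s (Fin.natAdd 2 t)) (fun t => hs _)
  obtain ⟨p, q, hpq⟩ := reach3 L (s (Fin.castAdd (d + 1) 0)) (s (Fin.castAdd (d + 1) 1)) a (hs _) (hs _)
  have h1 := hcount p q
  rw [hpq, ha, heven p q] at h1
  exact absurd h1 (by norm_num)

/-- **THE FAMILY HAS ECHO DEGREE `> d` at every input along every admissible placement of `≥ d + 3` sites.** -/
theorem hx_not_echoDeg {F d : ℕ} (hF : 2 + (d + 1) ≤ F) {b : Fin F → ℕ} (hb : SitesF N F b) (x : Fin N → Bool) :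
    ¬ EchoDeg d b (fun j : Fin N => hxStrat j) x := by
  intro hE
  have hN : 3 ≤ N := by have := hb.2 ⟨0, by omega⟩; omega
  obtain ⟨b', hb'def⟩ : ∃ b' : Fin (2 + (d + 1)) → ℕ, b' = fun i => b (Fin.castLE hF i) := ⟨_, rfl⟩
  have hb' : SitesF N (2 + (d + 1)) b' := hb'def ▸ sitesF_castLE hF hb
  have hE' : EchoDeg d b' (fun j : Fin N => hxStrat j) x := hb'def ▸ echoDeg_castLE hF hb.1 _ x hE
  have hk : ¬ (1 ≤ (⟨0, by omega⟩ : Fin N).val ∧ (⟨0, by omega⟩ : Fin N).val < N / 2) := by simp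
  obtain ⟨M, hMd, hM⟩ := hE' ⟨0, by omega⟩
  obtain ⟨s, hsdef⟩ : ∃ s : Fin (2 + (d + 1)) → ZMod 3, s = fun i => sgn3 (x (oddSiteF hb'.2 i)) := ⟨_, rfl⟩
  have hs0 : ∀ i, s i ≠ 0 := fun i => by rw [hsdef]; exact sgn3_ne _
  refine slice_not_lowDeg s hs0 ((lodd : CubeFn (ZMod 3) N) x)
    (fun ε => decide (∀ i ∈ pair02 N, orbF b' ε x i = true)) (fun p q τ => ?_) M hMd (fun ε => ?_)
  · -- the literal pair is constant on each subcube
    have hiff : (∀ i ∈ pair02 N, orbF b' (app p q τ) x i = true) ↔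
        (∀ i ∈ pair02 N, orbF b' (app p q fun _ => false) x i = true) := by
      refine forall₂_congr fun i hi => ?_
      have hi2 : i.val ≤ 2 := by have := (mem_filter.1 hi).2; omega
      rw [orbF_app_low hb' p q τ (fun _ => false) x i hi2]
    simp only [hiff]
  · -- the reader along the orbit
    rw [← hM ε, mem_dev_hx_iff _ _ hk]
    unfold rbit qbit
    rw [lodd_orbF_gen hb' ε x, hsdef]

/-- **… and so has the tree's pure half-counter family `hcStrat` (g19; COUNTER-FORM by g21's `wStrat`/`hcStrat` readings):**
the echo dial is skew to the counter dial — `apStrat` is counter-form AND echo-structured (rung 1), `hcStrat` is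
counter-form and high-echo, `AND`-readers are echo-structured and not counter-form, `hxStrat` is neither. -/
theorem hc_not_echoDeg {F d : ℕ} (hF : 2 + (d + 1) ≤ F) {b : Fin F → ℕ} (hb : SitesF N F b) (x : Fin N → Bool) :
    ¬ EchoDeg d b (fun j : Fin N => hcStrat j) x := by
  intro hE
  have hN : 3 ≤ N := by have := hb.2 ⟨0, by omega⟩; omega
  obtain ⟨b', hb'def⟩ : ∃ b' : Fin (2 + (d + 1)) → ℕ, b' = fun i => b (Fin.castLE hF i) := ⟨_, rfl⟩
  have hb' : SitesF N (2 + (d + 1)) b' := hb'def ▸ sitesF_castLE hF hb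
  have hE' : EchoDeg d b' (fun j : Fin N => hcStrat j) x := hb'def ▸ echoDeg_castLE hF hb.1 _ x hE
  have hk : ¬ (1 ≤ (⟨0, by omega⟩ : Fin N).val ∧ (⟨0, by omega⟩ : Fin N).val < N / 2) := by simp
  obtain ⟨M, hMd, hM⟩ := hE' ⟨0, by omega⟩
  obtain ⟨s, hsdef⟩ : ∃ s : Fin (2 + (d + 1)) → ZMod 3, s = fun i => sgn3 (x (oddSiteF hb'.2 i)) := ⟨_, rfl⟩
  have hs0 : ∀ i, s i ≠ 0 := fun i => by rw [hsdef]; exact sgn3_ne _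
  refine slice_not_lowDeg s hs0 ((lodd : CubeFn (ZMod 3) N) x) (fun _ => false) (fun _ _ _ => rfl) M hMd
    (fun ε => ?_)
  rw [← hM ε, mem_dev_hcStrat_iff _ _ hk, Bool.xor_false]
  unfold qbit
  rw [lodd_orbF_gen hb' ε x, hsdef]

/-- `EchoDeg` is insensitive to the zero gauge. -/
theorem echoDeg_pad_zero_iff {F d : ℕ} (b : Fin F → ℕ) (P : Fin N → CubeFn (ZMod 3) N) (x : Fin N → Bool) :
    EchoDeg d b (pad P (fun _ => 0)) x ↔ EchoDeg d b P x := by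
  unfold EchoDeg; simp only [dev_pad_zero]

/-- **hence the family is NOT cheaply echo-structured AT THE ZERO GAUGE** (`N ≥ 4`): for every echo degree `d` and
every admissible placement of `3(d+1)` sites, EVERY odd input has echo degree `> d`, so the a.e. clause fails
(`log₂ N · #odd > 2^(N-1)`).  Whether a non-zero cheap gauge could echo-structure it is left open, as for every
exemplar of a residual in this programme. -/
theorem hx_not_stabEcho_zero (hN : 4 ≤ N) :
    ¬ ∃ d : ℕ, d ≤ Nat.log 2 N ∧ ∃ b : Fin (3 * (d + 1)) → ℕ, SitesF N (3 * (d + 1)) b ∧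
      Nat.log 2 N * (univ.filter fun x : Fin N → Bool =>
        OddZeros x ∧ ¬ EchoDeg d b (pad (fun j : Fin N => hxStrat j) (fun _ => 0)) x).card ≤ 2 ^ (N - 1) := by
  rintro ⟨d, -, b, hb, hae⟩
  have hall : (univ.filter fun x : Fin N → Bool =>
      OddZeros x ∧ ¬ EchoDeg d b (pad (fun j : Fin N => hxStrat j) (fun _ => 0)) x) =
        univ.filter fun x : Fin N → Bool => OddZeros x := by
    refine filter_congr fun x _ => ⟨fun h => h.1, fun h => ⟨h, ?_⟩⟩
    rw [echoDeg_pad_zero_iff]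
    exact hx_not_echoDeg (by omega) hb x
  rw [hall] at hae
  have hL : 2 ≤ Nat.log 2 N := Nat.le_log_of_pow_le (by norm_num) (by omega)
  have hge : 2 ^ (N - 1) ≤ (univ.filter fun x : Fin N → Bool => OddZeros x).card := card_odd_ge (by omega)
  have hpos : 0 < 2 ^ (N - 1) := Nat.two_pow_pos _
  have := Nat.mul_le_mul hL hge
  omega

/-- **UNDECIDED(test) — the residual's named rung**: the half-counter × literal-pair family loses a polynomial
fraction of the odd class.  Not decided by any law of the lineage as typed: not dark / additive / echo-structured at the
zero gauge (above), not counter-form (above), not `BlindDial.Blind` (its reader sees the moved cells `0, 2`). -/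
def HxLoss3 : Prop :=
  ∃ C n₀ : ℕ, ∀ n ≥ n₀,
    ((univ.filter fun x : Fin n → Bool => OddZeros x ∧ Rel x (fun i => decide (hxStrat i x = 1))).card : ℝ)
      ≤ (1 - 1 / (n : ℝ) ^ C) * (2 : ℝ) ^ (n - 1)

/-- `D ⟹ HxLoss3` (at `c = 1`): the target speaks about the exhibited family. -/
theorem hxLoss3_of_dense (hD : DenseGenericLoss3) : HxLoss3 := by
  obtain ⟨a, C, h⟩ := hD
  obtain ⟨n₁, hn₁⟩ := h 1
  obtain ⟨n₂, hn₂⟩ := hx_in_dense_class a 1 le_rfl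
  refine ⟨C, max n₁ n₂, fun n hn => ?_⟩
  obtain ⟨hdeg, hgen⟩ := hn₂ n (le_trans (le_max_right _ _) hn)
  exact hn₁ n (le_trans (le_max_left _ _) hn) _ hdeg hgen

end Inhabitant

end Summit.QuantumAdvantage.QuantumAdvantage.Theorems.EchoDial
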